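import Summits.QuantumFields.BalabanUV.Beta.FP.TowerNWardOfStencilLaw

/-!
# `BalabanUV.Beta.FP.TowerNWardOfStencilLawWeighted` — row D1 ∕ (C1) OWNER «beta-an2», PART 122, ROUTE T (β1): **PART 118 §2's WEIGHT-`w` TWIN** — at the centred tower and the record's
# SYM graded composite tables with the MIXED SLOT AT GROUP WEIGHT `w` (`w • compMixG (ctrOff 4 Lc) Lc (j+1)` = PART 121's `(tabsCompGW …).mixFF`), the `hW𝒯 j`-shaped Ward transversality
# from the ONE located law (S)_j (`hSd`, displayed) + five pins, the W-side lock re-weighted to `cΛ·cE = 2·w` — the sym-presentation companion of PART 120 for an END″ at the weighted root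

HONEST DEPENDENCY (page 1, mandatory): continuum YM on T⁴ ⇐ BetaPertH ∧ nine spine estimates (0/9 proved); BetaPertH ⇐ (D1) ∧ (D4) ∧ CAP+tail;
G-an2-4 gates asym, D1 and NE2/3/4.  HONEST FRAMING (cell contract, verbatim): «discharging `BetaPertH` makes Bałaban's UV stability UNCONDITIONAL —
a real constructive-QFT result; it is NOT the continuum limit and NOT the Clay problem.»  ABSOLUTE RULE (cell charter, verbatim): «No internally-minted
statement may enter as a cited fact. Every hypothesis is either kernel-proved in this package or a verbatim quotation of a PUBLISHED theorem with page
reference. The manuscript(s) under audit are NOT citable for their own disputed steps — they are the thing under adjudication; programme-internal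
(2001/route/tribunal) claims are never citable.»

WHY (an2 g87∕88; `gen87/UNIT-JUNCTION-87.md` §8; PART 119 v3 `kappa2_of_scaledLocks`; road FP g65 A-6 (A) ∕ A-7 ∕ A-8; PART 120 `wardTransversal_AN_rooted_of_pins_weighted` p771793).  The
consistent END″ targets the root of record P5c∕D6 whose Λ∕multiplier∕mixed group carries `w = Lc¹²∕4`, flowing to `w_m = ((Lc⁴)^m)³∕4` (PART 121 `compGroupWeight`).  PART 120 typed the
rooted-graded presentation's `hW𝒯 j` at weight `w`; THIS FILE types the SYM-graded presentation's: PART 118 §2 `wardTransversal_AN_sym_of_stencilLaw` with the mixed slot `w • compMixG` and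
`hΛE : cΛ·cE = 2·w`.  As in PART 118 §2 the ONLY displayed law is (S)_j (`hSd`, located for the sym tables — FINDING AN2-86-1; by value at (2,3) the sym Wilson + border stage leaves
6.5–6.8e−2, `gen88/W2-WORDS-88.md` §3); every (W)_j letter is a tree theorem at any weight: Wilson PART 114, border PART 117 `hBord_compB_sym`, mixed PART 111's sym class∕parity with
`c₂ := w` under the lock `cH·w = ξ·cM 0` (⟸ `hΛE`), `M2Of_member_zero`, the table letter `compMixG_hmix` scaled by `StepJetData.biLoc_smul`, `compMixG_translate` under the scalar.
**`wardTransversal_AN_sym_of_stencilLaw_weighted`**; at `w = 1` (`one_smul`) the statement is PART 118 §2's text (not re-filed).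

WHAT: [folklore] composition BY NAME; no `def`, no `def … : Prop`, nothing cited, 0 sorry.  Nothing of Bałaban's asserted, valued or discharged; 0 estimates; 0∕4 row-D1 binders;
`hW𝒯 (j ≥ 1)` NOT claimed at the record of record ((S)_j stays DISPLAYED); no weighted record typed here; NOT (C1), NOT (T-ID), NOT D1, NEVER «G-an2-4 closed», NOT BetaPertH,
NOT continuum, NOT Clay.  Row D1 ∕ (C1) OWNER «beta-an2», gen 88, 2026-08-30.  No existing file touched.
-/


noncomputable section

open Finset
open scoped BigOperators
open Literature.MathematicalPhysics.QuantumFieldTheory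
open Literature.MathematicalPhysics.QuantumFieldTheory.Balaban1983to89
open Literature.MathematicalPhysics.QuantumFieldTheory.Balaban1983to89.Beta
open ExpKernelCalculus (MKer Decays BiLoc comp hessKer VertexFamily shiftK)
open PolarizationSign (WardTransversal)
open KernelWard (divV bdd_of_biLoc)
open AffineAveraging (Site box toSite)
open AveragingContoursRooted (ctrOff)
open OneStepResolventKernel (Fib LocStencil)
open OneStepKernelFamily (colH vertexOfK flipK)
open BalabanCompositeJets (LocStencil₂)
open SecondOrderResponse (colM dM LocStencilFM)
open BalabanStepW2 (M2Of)
open StepJetData (wilsonA biLoc_weaken)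
open WilsonBiStencil (wilsonW₂)
open WilsonVertex2Sym (wsym22)
open HessKerRate (biLoc_zero)
open Summit.QuantumFields.BalabanUV.Beta.TameKernelCalculus (trK)
open Summit.QuantumFields.BalabanUV.Beta.BorderedHessian (diagK sgnK)
open Summit.QuantumFields.BalabanUV.Beta.ChartConjugation (conjV)
open Summit.QuantumFields.BalabanUV.Beta.AxialDressingRooted (one_le_of_neZero)
open Summit.QuantumFields.BalabanUV.Beta.RelInvComposite (bhKcomp)
open Summit.QuantumFields.BalabanUV.Beta.AveragingWardRootedStencils (legInd)
open Summit.QuantumFields.BalabanUV.Beta.SpineRooted (SpureRecOf WrecOf S0NOf locStencil_SpureRecOf)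
open Summit.QuantumFields.BalabanUV.Beta.WardLocusRecursive (SrecOf SrecOf_zero)
open Summit.QuantumFields.BalabanUV.Beta.SpineRecursiveParity (parityOdd_zero)
open Summit.QuantumFields.BalabanUV.Beta.SymAveragingHessianCounts (symLinKerAt symVhKerAt symHessKerAt biLoc_smul_ff)
open Summit.QuantumFields.BalabanUV.Beta.SymAveragingMixedJetTables (symMixKerAt)
open Summit.QuantumFields.BalabanUV.Beta.CompositeVertexKernelRec (compVhS)
open Summit.QuantumFields.BalabanUV.Beta.CompositeHessianTable (compHessFF)
open Summit.QuantumFields.BalabanUV.Beta.CompositeTablesParity (trK_compVhS_sym trK_compHessFF_sym)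
open Summit.QuantumFields.BalabanUV.Beta.CompositeMixedTableGraded (compMixFFG compMixG)
open Summit.QuantumFields.BalabanUV.Beta.CompositeMixedTableGradedBounds (compMixG_hmix)
open Summit.QuantumFields.BalabanUV.Beta.CompositeMixedTableGradedCov (compMixG_translate)
open Summit.QuantumFields.BalabanUV.Beta.CompositeOneShotJets (compV compH compB compV_hV compH_hH compB_hB compV_hVt compH_hHt compB_hBt)
open Summit.QuantumFields.BalabanUV.Beta.CompositeOneShotJetData (Roots AN)
open Summit.QuantumFields.BalabanUV.Beta.NVertexSectors (decays_AN)
open Summit.QuantumFields.BalabanUV.Beta.WardLocusSymSockets (divV_SpureRecOf_eq_divV_SrecOf)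
open Summit.QuantumFields.BalabanUV.Beta.KernelWardMColumn (divV_dM_eq_conjV)
open Summit.QuantumFields.BalabanUV.Beta.CompositeMixedWardClass (M2Of_member_zero vertexFamily_mixedLetterRemainder_sym parityOdd_mixedLetterRemainder_sym)
open Summit.QuantumFields.BalabanUV.Beta.WilsonBiStencilWardSocketPins (hWil_wsym22_TW_su hWil''_wsym22_TW_su)
open Summit.QuantumFields.BalabanUV.Beta.CompositeVertexWardSymTwoBricks (hBord_compB_sym hBord''_compB_sym)
open Summit.QuantumFields.BalabanUV.Beta.FP.TowerNColumnWardLaw (colH_ward_AN colM_ward_AN)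
open Summit.QuantumFields.BalabanUV.Beta.FP.TowerRootCentredComposed (ctr_composedRoot_eq_s)
open Summit.QuantumFields.BalabanUV.Beta.FP.TowerNWardOfLetters (wardTransversal_AN_of_letters)
open Summit.QuantumFields.BalabanUV.Beta.FP.TowerNWardOfStencilLaw (wardTransversal_AN_of_stencilLaw)

namespace Summit.QuantumFields.BalabanUV.Beta.FP.TowerNWardOfStencilLawWeighted

section Sym

variable (Lc : ℕ) [NeZero Lc]

/-- [folklore] **`wardTransversal_AN_sym_of_stencilLaw_weighted` — PART 118 §2 WITH THE MIXED SLOT AT GROUP WEIGHT `w`.**  At the centred tower `Roots.ctr Lc` (odd `Lc`) and the record's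
SYM graded composite tables `compV∕compH∕compB (ctrOff 4 Lc) Lc (j+1)` with mixed slot `w • compMixG (ctrOff 4 Lc) Lc (j+1)`, multiplier family `cM • compH`: the `hW𝒯 j`-shaped Ward
transversality from the (S)-law `hSd` ALONE plus the pins `cE² = cE₂`, `2cB = cE·cVH`, `T = (8N_c²)⁻¹ • wsym22 N_c`, `cM 0 = cΛ`, and the WEIGHTED W-side lock `cΛ·cE = 2·w`. -/
theorem wardTransversal_AN_sym_of_stencilLaw_weighted (hLc : Odd Lc) {Nc : ℕ} (hNc : 2 ≤ Nc) (j : ℕ) (cM : ℕ → ℝ) (wt cE cVH cΛ cE₂ cB : ℝ)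
    {T : Fin 4 → Fin 4 → Fin 4 → Fin 4 → ℝ}
    (hcE₂ : cE ^ 2 = cE₂) (hcB : 2 * cB = cE * cVH)
    (hTW : T = (8 * (Nc : ℝ) ^ 2)⁻¹ • wsym22 Nc) (hcM0 : cM 0 = cΛ) (hΛE : cΛ * cE = 2 * wt)
    (hSd : ∀ y : Fin (3 + 1) → ℤ, ((((Lc ^ (j + 1) : ℕ) : ℝ)) ^ (3 + 1))⁻¹ • ∑ v ∈ box (3 + 1) (Lc ^ (j + 1)),
        divV (S0NOf 3 (Lc ^ (j + 1)) (compV (ctrOff (3 + 1) Lc) Lc (j + 1)) (compH (ctrOff (3 + 1) Lc) Lc (j + 1)) cE cVH cΛ)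
          ((((Lc ^ (j + 1) : ℕ) : ℤ)) • y + toSite v)
      = conjV (bhKcomp (d := 3) (Roots.ctr Lc).rc Lc (j + 1)) (diagK ((((((Lc ^ (j + 1) : ℕ) : ℝ)) ^ (3 + 1))⁻¹ * cE * (1 / 2)) •
          ∑ v ∈ box (3 + 1) (Lc ^ (j + 1)), legInd (toSite ((Roots.ctr Lc).s (j + 1))) ((((Lc ^ (j + 1) : ℕ) : ℤ)) • y + toSite v)))) :
    WardTransversal (flipK (hessKer (AN (Roots.ctr Lc) j)
      (vertexOfK (AN (Roots.ctr Lc) j) (Lc ^ (j + 1))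
        (SrecOf 3 (Lc ^ (j + 1)) (compV (ctrOff (3 + 1) Lc) Lc (j + 1)) (compH (ctrOff (3 + 1) Lc) Lc (j + 1)) (fun _ => AN (Roots.ctr Lc) j) cE cVH cΛ 0))
      (WrecOf 3 (Lc ^ (j + 1)) (fun _ => AN (Roots.ctr Lc) j)
        (SpureRecOf 3 (Lc ^ (j + 1)) (compV (ctrOff (3 + 1) Lc) Lc (j + 1)) (compH (ctrOff (3 + 1) Lc) Lc (j + 1)) (fun _ => AN (Roots.ctr Lc) j) cE cVH cΛ)
        (fun j' μ w => cM j' • compH (ctrOff (3 + 1) Lc) Lc (j + 1) μ w) cE₂ cB T (compB (ctrOff (3 + 1) Lc) Lc (j + 1)) (wt • compMixG (ctrOff (3 + 1) Lc) Lc (j + 1)) 0))) := by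
  have hL : 1 ≤ Lc := one_le_of_neZero Lc
  have hr : ctrOff (3 + 1) Lc ∈ box (3 + 1) Lc := (Roots.ctr Lc).hr
  have hrc : ∀ k : ℕ, (fun _ : ℕ => ctrOff (3 + 1) Lc) k ∈ box (3 + 1) Lc := fun _ => hr
  set cH : ℝ := ((((Lc ^ (j + 1) : ℕ) : ℝ)) ^ (3 + 1))⁻¹ with hcH
  set ξ : ℝ := ((((Lc ^ (j + 1) : ℕ) : ℝ)) ^ (3 + 1))⁻¹ * cE * (1 / 2) with hξ
  -- the composed root of the constant centred root list is the END's big root (PART 109 ∕ chair PROBE-K3)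
  have eR : ∑ k ∈ Finset.range (j + 1), ((Lc ^ k : ℕ) : ℤ) • toSite ((fun _ : ℕ => ctrOff (3 + 1) Lc) k) = toSite ((Roots.ctr Lc).s (j + 1)) :=
    ctr_composedRoot_eq_s hLc (j + 1)
  -- the table letters of the record's sym tables
  have hH : ∀ δ : ℝ, 0 ≤ δ → ∃ C : ℝ, VertexFamily (compH (ctrOff (3 + 1) Lc) Lc (j + 1)) (Lc ^ (j + 1)) C δ := compH_hH (j + 1) hL hr
  have hM : ∀ j' : ℕ, ∃ CM δ : ℝ, 0 < δ ∧ VertexFamily (fun μ w => cM j' • compH (ctrOff (3 + 1) Lc) Lc (j + 1) μ w) (Lc ^ (j + 1)) CM δ := fun j' => by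
    obtain ⟨C, hC⟩ := hH 1 zero_le_one
    exact ⟨_, 1, one_pos, fun μ w => biLoc_smul_ff (hC μ w) (cM j')⟩
  have hMt : ∀ (j' : ℕ) (μ : Fin (3 + 1)) (w t : Fin (3 + 1) → ℤ),
      (fun μ w => cM j' • compH (ctrOff (3 + 1) Lc) Lc (j + 1) μ w) μ (w + t) =
        shiftK (-((((Lc ^ (j + 1) : ℕ) : ℤ)) • t)) ((fun μ w => cM j' • compH (ctrOff (3 + 1) Lc) Lc (j + 1) μ w) μ w) := by
    intro j' μ w t
    funext x z a b
    simp only [Pi.smul_apply, smul_eq_mul, shiftK]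
    rw [compH_hHt (j + 1) μ w t]
    rfl
  have hM0 : (fun j' μ w => cM j' • compH (ctrOff (3 + 1) Lc) Lc (j + 1) μ w) 0 = cΛ • compH (ctrOff (3 + 1) Lc) Lc (j + 1) := by
    funext μ w; simp only [hcM0, Pi.smul_apply]
  -- the scalar locks from the pin rows
  have hlockB : cH * cB = ξ * cVH := by rw [hξ]; linear_combination (((((Lc ^ (j + 1) : ℕ) : ℝ)) ^ (3 + 1))⁻¹ / 2) * hcB
  have hlockM : cH * wt = ξ * cM 0 := by
    rw [hξ, hcM0]; linear_combination (-(((((Lc ^ (j + 1) : ℕ) : ℝ)) ^ (3 + 1))⁻¹ / 2)) * hΛE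
  have hcE₂' : cE₂ = cE ^ 2 := hcE₂.symm
  -- the mixed remainder's identification with PART 111's (`c₂ = 1`, `M2Of … 0` spelled out)
  have eRM : ∀ (y : Fin (3 + 1) → ℤ) (ρ' : Fin (3 + 1)) (w : Fin (3 + 1) → ℤ),
      cH • ∑ v ∈ box (3 + 1) (Lc ^ (j + 1)), divV (fun κ u => M2Of 3 (Lc ^ (j + 1)) (wt • compMixG (ctrOff (3 + 1) Lc) Lc (j + 1)) 0 κ u ρ' w)
          ((((Lc ^ (j + 1) : ℕ) : ℤ)) • y + toSite v) -
        (comp ((fun μ w => cM 0 • compH (ctrOff (3 + 1) Lc) Lc (j + 1) μ w) ρ' w)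
            (diagK (ξ • ∑ v ∈ box (3 + 1) (Lc ^ (j + 1)), legInd (toSite ((Roots.ctr Lc).s (j + 1))) ((((Lc ^ (j + 1) : ℕ) : ℤ)) • y + toSite v))) -
          comp (diagK (ξ • ∑ v ∈ box (3 + 1) (Lc ^ (j + 1)), legInd (toSite ((Roots.ctr Lc).s (j + 1))) ((((Lc ^ (j + 1) : ℕ) : ℤ)) • y + toSite v)))
            ((fun μ w => cM 0 • compH (ctrOff (3 + 1) Lc) Lc (j + 1) μ w) ρ' w)) =
      cH • ∑ v ∈ box (3 + 1) (Lc ^ (j + 1)), divV (fun κ u => wt • compMixFFG (fun k => symLinKerAt (toSite ((fun _ : ℕ => ctrOff (3 + 1) Lc) k)) Lc)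
          (fun k => symVhKerAt (toSite ((fun _ : ℕ => ctrOff (3 + 1) Lc) k)) Lc) (fun k => symHessKerAt (toSite ((fun _ : ℕ => ctrOff (3 + 1) Lc) k)) Lc)
          (fun k => symMixKerAt (toSite ((fun _ : ℕ => ctrOff (3 + 1) Lc) k)) Lc) Lc (j + 1) κ u ρ' w) ((((Lc ^ (j + 1) : ℕ) : ℤ)) • y + toSite v) -
        (comp (cM 0 • compHessFF (fun k => symLinKerAt (toSite ((fun _ : ℕ => ctrOff (3 + 1) Lc) k)) Lc) (fun k => symHessKerAt (toSite ((fun _ : ℕ => ctrOff (3 + 1) Lc) k)) Lc)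
              Lc (j + 1) ρ' w)
            (diagK (ξ • ∑ v ∈ box (3 + 1) (Lc ^ (j + 1)), legInd (toSite ((Roots.ctr Lc).s (j + 1))) ((((Lc ^ (j + 1) : ℕ) : ℤ)) • y + toSite v))) -
          comp (diagK (ξ • ∑ v ∈ box (3 + 1) (Lc ^ (j + 1)), legInd (toSite ((Roots.ctr Lc).s (j + 1))) ((((Lc ^ (j + 1) : ℕ) : ℤ)) • y + toSite v)))
            (cM 0 • compHessFF (fun k => symLinKerAt (toSite ((fun _ : ℕ => ctrOff (3 + 1) Lc) k)) Lc) (fun k => symHessKerAt (toSite ((fun _ : ℕ => ctrOff (3 + 1) Lc) k)) Lc)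
              Lc (j + 1) ρ' w)) := by
    intro y ρ' w
    simp only [M2Of_member_zero, Pi.smul_apply]
    rfl
  obtain ⟨CR, δR, hδR, hRM⟩ := vertexFamily_mixedLetterRemainder_sym (d := 3) (L := Lc) (r := fun _ : ℕ => ctrOff (3 + 1) Lc) hL hrc (Lc ^ (j + 1)) (j + 1)
    (toSite ((Roots.ctr Lc).s (j + 1))) cH wt (cM 0) ξ
  have hCR : 0 ≤ CR := (hRM 0 0 0).nonneg (Sum.inl 0)
  have hZ : ∀ Y : Fin (3 + 1) → ℤ, LocStencil ((fun (_ : Fin (3 + 1) → ℤ) (_ : Fin (3 + 1)) (_ : Fin (3 + 1) → ℤ) => (0 : MKer (3 + 1) (Fib 3))) Y) CR δR :=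
    fun Y κ u => biLoc_weaken (biLoc_zero (F := Fib 3) u u δR) hCR le_rfl
  have hZp : ∀ (Y : Fin (3 + 1) → ℤ) (κ : Fin (3 + 1)) (u : Fin (3 + 1) → ℤ),
      trK ((fun (_ : Fin (3 + 1) → ℤ) (_ : Fin (3 + 1)) (_ : Fin (3 + 1) → ℤ) => (0 : MKer (3 + 1) (Fib 3))) Y κ u) =
        -sgnK ((fun (_ : Fin (3 + 1) → ℤ) (_ : Fin (3 + 1)) (_ : Fin (3 + 1) → ℤ) => (0 : MKer (3 + 1) (Fib 3))) Y κ u) := fun _ _ _ => parityOdd_zero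
  -- the border letters: PART 117 at the constant centred root list, composed root = the big root
  have hBo : ∀ (Y : Fin (3 + 1) → ℤ) (κ' : Fin (3 + 1)) (u' : Fin (3 + 1) → ℤ),
      cH • ∑ v ∈ box (3 + 1) (Lc ^ (j + 1)), divV (fun κ u => cB • compB (ctrOff (3 + 1) Lc) Lc (j + 1) κ u κ' u') ((((Lc ^ (j + 1) : ℕ) : ℤ)) • Y + toSite v) =
        comp (cVH • compV (ctrOff (3 + 1) Lc) Lc (j + 1) κ' u') (diagK (ξ • ∑ v ∈ box (3 + 1) (Lc ^ (j + 1)), legInd (toSite ((Roots.ctr Lc).s (j + 1))) ((((Lc ^ (j + 1) : ℕ) : ℤ)) • Y + toSite v)))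
          - comp (diagK (ξ • ∑ v ∈ box (3 + 1) (Lc ^ (j + 1)), legInd (toSite ((Roots.ctr Lc).s (j + 1))) ((((Lc ^ (j + 1) : ℕ) : ℤ)) • Y + toSite v))) (cVH • compV (ctrOff (3 + 1) Lc) Lc (j + 1) κ' u')
          + (fun (_ : Fin (3 + 1) → ℤ) (_ : Fin (3 + 1)) (_ : Fin (3 + 1) → ℤ) => (0 : MKer (3 + 1) (Fib 3))) Y κ' u' := by
    intro Y κ' u'
    have h := hBord_compB_sym (d := 3) (r := fun _ : ℕ => ctrOff (3 + 1) Lc) hL hrc (j + 1) hlockB Y κ' u'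
    rw [eR] at h
    exact h.trans (by simp only [add_zero]; rfl)
  have hBo'' : ∀ (Y : Fin (3 + 1) → ℤ) (κ : Fin (3 + 1)) (u : Fin (3 + 1) → ℤ),
      cH • ∑ v ∈ box (3 + 1) (Lc ^ (j + 1)), divV (fun κ' u' => cB • compB (ctrOff (3 + 1) Lc) Lc (j + 1) κ u κ' u') ((((Lc ^ (j + 1) : ℕ) : ℤ)) • Y + toSite v) =
        comp (cVH • compV (ctrOff (3 + 1) Lc) Lc (j + 1) κ u) (diagK (ξ • ∑ v ∈ box (3 + 1) (Lc ^ (j + 1)), legInd (toSite ((Roots.ctr Lc).s (j + 1))) ((((Lc ^ (j + 1) : ℕ) : ℤ)) • Y + toSite v)))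
          - comp (diagK (ξ • ∑ v ∈ box (3 + 1) (Lc ^ (j + 1)), legInd (toSite ((Roots.ctr Lc).s (j + 1))) ((((Lc ^ (j + 1) : ℕ) : ℤ)) • Y + toSite v))) (cVH • compV (ctrOff (3 + 1) Lc) Lc (j + 1) κ u)
          + (fun (_ : Fin (3 + 1) → ℤ) (_ : Fin (3 + 1)) (_ : Fin (3 + 1) → ℤ) => (0 : MKer (3 + 1) (Fib 3))) Y κ u := by
    intro Y κ u
    have h := hBord''_compB_sym (d := 3) (r := fun _ : ℕ => ctrOff (3 + 1) Lc) hL hrc (j + 1) hlockB Y κ u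
    rw [eR] at h
    exact h.trans (by simp only [add_zero]; rfl)
  -- the mixed remainder's parity: PART 111's sym instance under the lock
  have hRMp : ∀ (y : Fin (3 + 1) → ℤ) (ρ' : Fin (3 + 1)) (w : Fin (3 + 1) → ℤ),
      trK (cH • ∑ v ∈ box (3 + 1) (Lc ^ (j + 1)), divV (fun κ u => M2Of 3 (Lc ^ (j + 1)) (wt • compMixG (ctrOff (3 + 1) Lc) Lc (j + 1)) 0 κ u ρ' w)
          ((((Lc ^ (j + 1) : ℕ) : ℤ)) • y + toSite v) -
        (comp ((fun μ w => cM 0 • compH (ctrOff (3 + 1) Lc) Lc (j + 1) μ w) ρ' w)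
            (diagK (ξ • ∑ v ∈ box (3 + 1) (Lc ^ (j + 1)), legInd (toSite ((Roots.ctr Lc).s (j + 1))) ((((Lc ^ (j + 1) : ℕ) : ℤ)) • y + toSite v))) -
          comp (diagK (ξ • ∑ v ∈ box (3 + 1) (Lc ^ (j + 1)), legInd (toSite ((Roots.ctr Lc).s (j + 1))) ((((Lc ^ (j + 1) : ℕ) : ℤ)) • y + toSite v)))
            ((fun μ w => cM 0 • compH (ctrOff (3 + 1) Lc) Lc (j + 1) μ w) ρ' w))) =
      -sgnK (cH • ∑ v ∈ box (3 + 1) (Lc ^ (j + 1)), divV (fun κ u => M2Of 3 (Lc ^ (j + 1)) (wt • compMixG (ctrOff (3 + 1) Lc) Lc (j + 1)) 0 κ u ρ' w)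
          ((((Lc ^ (j + 1) : ℕ) : ℤ)) • y + toSite v) -
        (comp ((fun μ w => cM 0 • compH (ctrOff (3 + 1) Lc) Lc (j + 1) μ w) ρ' w)
            (diagK (ξ • ∑ v ∈ box (3 + 1) (Lc ^ (j + 1)), legInd (toSite ((Roots.ctr Lc).s (j + 1))) ((((Lc ^ (j + 1) : ℕ) : ℤ)) • y + toSite v))) -
          comp (diagK (ξ • ∑ v ∈ box (3 + 1) (Lc ^ (j + 1)), legInd (toSite ((Roots.ctr Lc).s (j + 1))) ((((Lc ^ (j + 1) : ℕ) : ℤ)) • y + toSite v)))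
            ((fun μ w => cM 0 • compH (ctrOff (3 + 1) Lc) Lc (j + 1) μ w) ρ' w))) := by
    intro y ρ' w
    rw [eRM y ρ' w]
    exact parityOdd_mixedLetterRemainder_sym (d := 3) hL hrc (Lc ^ (j + 1)) (j + 1) y (toSite ((Roots.ctr Lc).s (j + 1))) ρ' w hlockM
  -- the WEIGHTED mixed slot inherits the table letter (constant `|w|·C`, same rate)
  have hmixw : ∃ C δ : ℝ, 0 < δ ∧ LocStencilFM (Lc ^ (j + 1)) (wt • compMixG (ctrOff (3 + 1) Lc) Lc (j + 1)) C δ := by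
    obtain ⟨C, δ, hδ, h⟩ := compMixG_hmix hL hr (j + 1)
    refine ⟨|wt| * C, δ, hδ, fun κ u ρ y => ?_⟩
    have h1 := StepJetData.biLoc_smul (h κ u ρ y) wt
    rw [← mul_assoc] at h1
    exact h1
  subst hTW
  exact wardTransversal_AN_of_stencilLaw (Roots.ctr Lc) j (compV_hV (j + 1) hL hr) hH (compV_hVt (j + 1) hL) (compH_hHt (j + 1))
    (fun κ u => trK_compVhS_sym (j + 1) κ u) (fun μ y => trK_compHessFF_sym (j + 1) μ y)
    hM hMt cE cVH cΛ cE₂ cB hM0 _ (compB_hB (j + 1) hL hr) (compB_hBt (j + 1) hL) hmixw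
    (fun κ u μ w t => by simp only [Pi.smul_apply, compMixG_translate (j + 1) κ u μ w t]; rfl) ξ
    hSd
    (RW := fun _ _ _ => 0) (RW'' := fun _ _ _ => 0) (RB := fun _ _ _ => 0) (RB'' := fun _ _ _ => 0)
    (RM := fun y ρ' w => cH • ∑ v ∈ box (3 + 1) (Lc ^ (j + 1)), divV (fun κ u => M2Of 3 (Lc ^ (j + 1)) (wt • compMixG (ctrOff (3 + 1) Lc) Lc (j + 1)) 0 κ u ρ' w)
          ((((Lc ^ (j + 1) : ℕ) : ℤ)) • y + toSite v) -
        (comp ((fun μ w => cM 0 • compH (ctrOff (3 + 1) Lc) Lc (j + 1) μ w) ρ' w)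
            (diagK (ξ • ∑ v ∈ box (3 + 1) (Lc ^ (j + 1)), legInd (toSite ((Roots.ctr Lc).s (j + 1))) ((((Lc ^ (j + 1) : ℕ) : ℤ)) • y + toSite v))) -
          comp (diagK (ξ • ∑ v ∈ box (3 + 1) (Lc ^ (j + 1)), legInd (toSite ((Roots.ctr Lc).s (j + 1))) ((((Lc ^ (j + 1) : ℕ) : ℤ)) • y + toSite v)))
            ((fun μ w => cM 0 • compH (ctrOff (3 + 1) Lc) Lc (j + 1) μ w) ρ' w)))
    ⟨CR, δR, hδR, hZ, hZ, hZ, hZ, fun y ρ' w => by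
      have h := hRM y ρ' w
      dsimp only at h ⊢
      rw [← eRM y ρ' w] at h
      exact h⟩
    hZp hZp hZp hZp hRMp
    (fun Y κ' u' => hWil_wsym22_TW_su (L := Lc ^ (j + 1)) hNc (toSite ((Roots.ctr Lc).s (j + 1))) hcE₂' Y κ' u')
    (fun Y κ u => hWil''_wsym22_TW_su (L := Lc ^ (j + 1)) hNc (toSite ((Roots.ctr Lc).s (j + 1))) hcE₂' Y κ u)
    hBo hBo'' (fun y ρ' w => by dsimp only; abel)


end Sym

end Summit.QuantumFields.BalabanUV.Beta.FP.TowerNWardOfStencilLawWeighted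

end
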